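import Summits.BirchSwinnertonDyer.BirchSwinnertonDyer.Theorems.ManinLocalTwoThreeManinOddOfReducibleOfCuspidalKummer
import Summits.BirchSwinnertonDyer.BirchSwinnertonDyer.Theorems.ManinLocalTwoThreeManinOddOfOddEtaExponent
import Summits.BirchSwinnertonDyer.BirchSwinnertonDyer.Theorems.ManinLocalTwoThreeOddDegreeTooth
import Summits.BirchSwinnertonDyer.Rank1Residual.ManinAdditive.OddDegreeTooth
import Summits.BirchSwinnertonDyer.Rank1Residual.ManinAdditive.ShimuraLedger
import Literature.NumberTheory.EllipticCurves.BSDSelmerSmithNoRationalTwoTorsionProofs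
import HarnessLib

/-!
# The blind residual of C2 BY NAME: `RbTotallyBlind` (an g16) ⟹ E-an-50 ⟹ the v10 stub; tame half ⟸ ČNS ∧ E-an-73

Summit `BirchSwinnertonDyer`, route `ManinLocalTwoThree` (cell bsd-f2-manin), crux C2 `ManinOddAtFour` (stmt-BirchSwinnertonDyer-22967),
line `kato_shift_two`, skeleton v10, stub `stub_blindOrbitMinimalResidual` (the orbit-minimal totally Kummer-blind residual).  The
cell now has the blind residual typed BY NAME twice — an g14's `CuspidalKummer.KummerBlindResidualOdd` (E-an-50, integer-root form)
and an g16/g17's `ShimuraLedger.RbTotallyBlind` = `OddDegreeTooth.RbTotallyBlindTame` ∧ `…RbTotallyBlindWild` (rational-root form,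
typer p623346/p624392) — and the tame parity law E-an-73 `BlindTameOptimalOddDegree`.  THIS FILE supplies the kernel edges that
connect them to the registered stub:

* `kummerBlindResidualOdd_of_rbTotallyBlind : RbTotallyBlind → KummerBlindResidualOdd` (integer roots of the 2-division
  cubic of a globally minimal `a₁ = a₃ = 0` equation are the rational ones: rational root theorem);
* `blindOrbitMinimalResidual_of_rbTotallyBlindTame_of_wild : RbTotallyBlindTame → RbTotallyBlindWild → ` (v10 stub 6c verbatim);
* `rbTotallyBlindTame_of_cns_of_blindTameOptimalOddDegree : ČNS → modularity → BlindTameOptimalOddDegree → RbTotallyBlindTame`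
  (an g17's redirect, through the lead's E-an-72 `not_two_dvd_maninConstant_of_cns_of_odd_deg`, p621478);
* C2 corollaries BY NAME: `ManinOddAtFour ⟸ F♯ ∧ E-an-48 ∧ E-an-53 ∧ RbTotallyBlindTame ∧ RbTotallyBlindWild` and
  `ManinOddAtFour ⟸ F♯ ∧ E-an-48 ∧ E-an-53 ∧ ČNS ∧ E-an-73 ∧ RbTotallyBlindWild` (E-an-52 by p2's theorem).

CONDITIONAL edges; nothing about BSD or Manin's conjecture is proved. [folklore]
-/

set_option autoImplicit false
set_option linter.dupNamespace false

noncomputable section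

open scoped Classical MatrixGroups ModularForm
open PowerSeries CongruenceSubgroup
open WeierstrassCurve Literature.NumberTheory.EllipticCurves Literature.NumberTheory.EllipticCurves.ModularForms
open Summit.BirchSwinnertonDyer.Rank1Residual.ManinAdditive
open Summit.BirchSwinnertonDyer.Rank1Residual.ManinAdditive.CuspidalKummer
open Summit.BirchSwinnertonDyer.Rank1Residual.ManinAdditive.ShimuraLedger
open Summit.BirchSwinnertonDyer.Rank1Residual.ManinAdditive.OddDegreeTooth

namespace Summit.BirchSwinnertonDyer.BirchSwinnertonDyer.Theorems.ManinLocalTwoThree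

/-- On an `a₁ = a₃ = 0` equation the 2-division cubic `4x³ + b₂x² + 2b₄x + b₆` is `4(x³ + a₂x² + a₄x + a₆)`. [folklore] -/
theorem isRoot_twoTorsionPolynomial_iff_of_a₁_a₃ (W : WeierstrassCurve ℚ) (h₁ : W.a₁ = 0) (h₃ : W.a₃ = 0) (e : ℚ) :
    W.twoTorsionPolynomial.toPoly.IsRoot e ↔ e ^ 3 + W.a₂ * e ^ 2 + W.a₄ * e + W.a₆ = 0 := by
  rw [isRoot_twoTorsionPolynomial_iff]
  simp only [WeierstrassCurve.b₂, WeierstrassCurve.b₄, WeierstrassCurve.b₆, h₁, h₃]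
  constructor
  · intro h; linear_combination h / 4
  · intro h; linear_combination 4 * h

/-- **`RbTotallyBlind → KummerBlindResidualOdd`** (an g16's rational-root form implies an g14's integer-root form E-an-50):
on a globally minimal `a₁ = a₃ = 0` equation every rational root of the 2-division cubic is an integer (rational root
theorem), so «all integral roots blind» gives «all rational roots blind». [folklore] -/
theorem kummerBlindResidualOdd_of_rbTotallyBlind (h : RbTotallyBlind) : KummerBlindResidualOdd := by
  intro W _ _ N _ D hopt h4 a₂ a₄ hW₁ hW₃ hW₂ hW₄ hex hall
  have h4' : 2 ^ 2 ∣ N := by norm_num; exact h4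
  set M : WeierstrassCurve ℤ := integralModelInt W with hM
  have hWM : M.map (Int.castRingHom ℚ) = W := map_integralModelInt W
  have hM1 : M.a₁ = 0 := by
    have h := hW₁; rw [← hWM, map_a₁, eq_intCast] at h; exact_mod_cast h
  have hM3 : M.a₃ = 0 := by
    have h := hW₃; rw [← hWM, map_a₃, eq_intCast] at h; exact_mod_cast h
  refine h W D hopt h4' hW₁ hW₃ ?_ ?_
  · obtain ⟨e, he⟩ := hex
    exact ⟨(e : ℚ), (isRoot_twoTorsionPolynomial_iff_of_a₁_a₃ W hW₁ hW₃ _).mp he⟩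
  · intro e he
    have he' : W.twoTorsionPolynomial.toPoly.IsRoot e := (isRoot_twoTorsionPolynomial_iff_of_a₁_a₃ W hW₁ hW₃ e).mpr he
    have heM : (M.map (Int.castRingHom ℚ)).twoTorsionPolynomial.toPoly.IsRoot e := by rw [hWM]; exact he'
    obtain ⟨E, rfl⟩ := exists_intCast_eq_of_isRoot_twoTorsionPolynomial M hM1 hM3 heM
    exact ⟨a₂, a₄, E, hW₂.symm, hW₄.symm, rfl, hall E he'⟩

/-- **The v10 stub from the named blind residual**: `RbTotallyBlindTame ∧ RbTotallyBlindWild ⟹ stub_blindOrbitMinimalResidual`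
(an's split `rbTotallyBlind_of_tame_of_wild`, then E-an-50, then the lead's `blindOrbitMinimalResidual_of_kummerBlindResidualOdd`).
[folklore] -/
theorem blindOrbitMinimalResidual_of_rbTotallyBlindTame_of_wild (ht : RbTotallyBlindTame) (hw : RbTotallyBlindWild) :
    ∀ (W : WeierstrassCurve ℚ) [W.IsElliptic] [W.IsGloballyMinimal] {N : ℕ} [NeZero N]
      (D : ModularParametrizationData W N),
      (∀ z ∈ D.L.lattice, ∃ w ∈ periodLattice D.f, z = D.c * w) → 2 ^ 2 ∣ N →
      ¬ (∃ (W' : WeierstrassCurve ℚ) (d : ℤ), W'.IsElliptic ∧ W'.IsGloballyMinimal ∧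
        (d = -1 ∨ d = 2 ∨ d = -2) ∧ IsIsogenous W (W'.quadraticTwist (d : ℚ)) ∧
        ¬ 2 ^ 2 ∣ W'.conductorNorm ℤ) →
      ¬ (∃ (W' : WeierstrassCurve ℚ) (q : ℕ), W'.IsElliptic ∧ W'.IsGloballyMinimal ∧
        q.Prime ∧ q ≠ 2 ∧ q ^ 2 ∣ N ∧
        IsIsogenous W (W'.quadraticTwist (((-1 : ℤ) ^ (q / 2) * q : ℤ) : ℚ)) ∧
        ¬ q ^ 2 ∣ W'.conductorNorm ℤ) →
      ¬ (∃ (A : WeierstrassCurve ℚ), A.IsElliptic ∧ A.IsGloballyMinimal ∧ 2 ^ 4 ∣ N ∧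
        2 ^ 2 ∣ A.conductorNorm ℤ ∧ A.conductorNorm ℤ ∣ N ∧ A.conductorNorm ℤ < N ∧
        IsIsogenous W (A.quadraticTwist ((-1 : ℤ) : ℚ))) →
      ¬ (∃ (A : WeierstrassCurve ℚ) (_ : A.IsElliptic) (_ : A.IsGloballyMinimal) (N' : ℕ) (_ : NeZero N')
        (D' : ModularParametrizationData A N') (d : ℤ) (C : WeierstrassCurve ℚ) (u : VariableChange ℚ),
        C.IsElliptic ∧ C.IsGloballyMinimal ∧
        (∀ z ∈ D'.L.lattice, ∃ w ∈ periodLattice D'.f, z = D'.c * w) ∧ (d = 2 ∨ d = -2) ∧ 2 ^ 6 ∣ N ∧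
        2 ^ 2 ∣ A.conductorNorm ℤ ∧ A.conductorNorm ℤ ∣ N ∧
        IsIsogenous W (A.quadraticTwist (d : ℚ)) ∧ u • A.quadraticTwist (d : ℚ) = C ∧
        C.Δ = (d : ℚ) ^ 6 * A.Δ ∧
        (A.conductorNorm ℤ < N ∨ A.minimalDiscriminantInt.natAbs < W.minimalDiscriminantInt.natAbs)) →
      ¬ (∃ (A : WeierstrassCurve ℚ) (_ : A.IsElliptic) (_ : A.IsGloballyMinimal)
        (D' : ModularParametrizationData A N) (q : ℕ) (C : WeierstrassCurve ℚ) (u : VariableChange ℚ),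
        C.IsElliptic ∧ C.IsGloballyMinimal ∧
        (∀ z ∈ D'.L.lattice, ∃ w ∈ periodLattice D'.f, z = D'.c * w) ∧ q.Prime ∧ q ≠ 2 ∧ q ^ 2 ∣ N ∧
        IsIsogenous C W ∧ u • A.quadraticTwist (((-1 : ℤ) ^ (q / 2) * q : ℤ) : ℚ) = C ∧
        C.Δ = ((((-1 : ℤ) ^ (q / 2) * q : ℤ)) : ℚ) ^ 6 * A.Δ ∧
        A.minimalDiscriminantInt.natAbs < W.minimalDiscriminantInt.natAbs) →
      ∀ (C : VariableChange ℚ) (M : WeierstrassCurve ℤ), C.u = 1 → C • W = M.map (Int.castRingHom ℚ) →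
        M.a₁ = 0 → M.a₃ = 0 → (C • W).IsGloballyMinimal →
        (∃ e : ℤ, (C • W).twoTorsionPolynomial.toPoly.IsRoot (e : ℚ)) →
        (∀ e : ℤ, (C • W).twoTorsionPolynomial.toPoly.IsRoot (e : ℚ) → KummerBlindAtTwo M.a₂ M.a₄ e) →
        ¬ (2 : ℤ) ∣ D.c :=
  blindOrbitMinimalResidual_of_kummerBlindResidualOdd
    (kummerBlindResidualOdd_of_rbTotallyBlind (rbTotallyBlind_of_tame_of_wild ht hw))

/-- **an g17's REDIRECT, in the tree**: modulo the printed ČNS Thm 1.2 and modularity, the blind TAME residual is the `c`-free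
parity law E-an-73 (through the lead's E-an-72 `not_two_dvd_maninConstant_of_cns_of_odd_deg`).
[cite: CesnaviciusNeururerSaha2023, Thm. 1.2] -/
theorem rbTotallyBlindTame_of_cns_of_blindTameOptimalOddDegree (hcns : cesnaviciusNeururerSaha_thm_1_2)
    (hnf : exists_isNewformOf) (hodd : BlindTameOptimalOddDegree) : RbTotallyBlindTame := by
  intro W _ _ N _ D hopt h4 h8 ha₁ ha₃ hT hall
  exact not_two_dvd_maninConstant_of_cns_of_odd_deg hcns hnf W D (Or.inl h8) (hodd W D hopt h4 h8 ha₁ ha₃ hT hall)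

/-- **C2 BY NAME from F♯, K_geo, E-an-53 and the two NAMED blind residuals** (tame and wild).  CONDITIONAL.
[cite: Kato2004Asterisque, Thm. 9.7 (p. 189)] -/
theorem maninOddAtFour_of_katoFact_of_cuspidalKummer_of_blindTame_of_blindWild
    (hF : kato_neron_isIntegral_twistedSymbolSum_of_additive_two_real)
    (h48 : CuspidalKummerRepresentativeAtFour) (h53 : CuspidalKummerOddExponent)
    (ht : RbTotallyBlindTame) (hw : RbTotallyBlindWild) :
    Summit.BirchSwinnertonDyer.BirchSwinnertonDyer.Theses.ManinLocalTwoThree.ManinOddAtFour :=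
  maninOddAtFour_of_katoFact_of_cuspidalKummer_of_blindOrbitMinimal hF h48 h53 ManinOddOfOddEtaExponent_holds
    (blindOrbitMinimalResidual_of_rbTotallyBlindTame_of_wild ht hw)

/-- **C2 BY NAME from F♯, K_geo, E-an-53, the printed ČNS bound (+ modularity), the tame parity law E-an-73 and the WILD blind
residual.**  CONDITIONAL. [cite: CesnaviciusNeururerSaha2023, Thm. 1.2] [cite: Kato2004Asterisque, Thm. 9.7 (p. 189)] -/
theorem maninOddAtFour_of_katoFact_of_cuspidalKummer_of_cns_of_oddDegree_of_blindWild
    (hF : kato_neron_isIntegral_twistedSymbolSum_of_additive_two_real)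
    (h48 : CuspidalKummerRepresentativeAtFour) (h53 : CuspidalKummerOddExponent)
    (hcns : cesnaviciusNeururerSaha_thm_1_2) (hnf : exists_isNewformOf) (h73 : BlindTameOptimalOddDegree)
    (hw : RbTotallyBlindWild) :
    Summit.BirchSwinnertonDyer.BirchSwinnertonDyer.Theses.ManinLocalTwoThree.ManinOddAtFour :=
  maninOddAtFour_of_katoFact_of_cuspidalKummer_of_blindTame_of_blindWild hF h48 h53
    (rbTotallyBlindTame_of_cns_of_blindTameOptimalOddDegree hcns hnf h73) hw

end Summit.BirchSwinnertonDyer.BirchSwinnertonDyer.Theorems.ManinLocalTwoThree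

end
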